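import Literature.NumberTheory.EllipticCurves.PointCountEulerCriterion
import HarnessLib

/-!
# BSD rank-≤1 residual cell, class X11b (Jetchev–Cha-certificate pairs of unit `b2b-bsdres-x11c`):
# Frobenius point-count certificates `#Ẽ(𝔽_ℓ) = n` for the Tamagawa-obstructed models (kernel-decided data; part 2 of 2)

HONEST FRAMING (cell `b2b-bsdres-*`, verbatim): prove what is provable now; shrink each hard class
to its core with data; no claim beyond stated classes; COMBINATION classes deleted from PUBLISHED
theorems only, CONSTRUCTION-shaped remainder typed; this is not "finishing BSD". Class X11b stays
CONSTRUCTION-SHAPED; everything here is PER PAIR; no lane verdict is changed; no named fact.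

Theorems only (kernel-decided data: no definition, no named fact, no `native_decide`), in the exact
shape of `X11b/ChaPairsCards.lean` (gen 3; `card_c<label>_<ℓ>`): for each of the 37 Tamagawa-obstructed
RESISTANT pairs of X11 ∧ r = 1 ∧ ¬sst ∧ p ≥ 5 that carry a Jetchev–Cha certificate
(HOME/b2b-bsdres-x11c/REPORT.md §12; all at `p = 5`, `ρ̄_{E,5}` of image `5S4`/`5Ns`, `5 ∣ c_q` at one
bad prime `q`) and ONE odd prime `ℓ` of good reduction (`ℓ ∤ Δ`, `ℓ ≠ 5`, the smallest one for which
`X² − a_ℓX + ℓ` has no root modulo `5`), the point count `#Ẽ(𝔽_ℓ) = n` of the reduction of Cremona's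
model, decided by the kernel through `WeierstrassCurve.natCard_point_eq_one_add_card` and
`card_sol_eq_sum_euler`. Consumers: `X11b/JetchevChaPairs{1,…,5}.lean` (`a_ℓ = ℓ + 1 − n`; `E[5]`
irreducible by Mazur 1978 Prop. 6.3 (1) via `IntModel.hasIrreducibleModPGaloisRep_of_intModel_of_noroot`).
Witnesses found by the gen-3 script `code/b2b-bsdres-x11c/gen3/lean_gen/compute_pairs.py` (naive count);
the kernel RE-VERIFIES every count. Labels in this part: `169920cp1`, `169920dc1`, `184960ce1`, `208080j1`, `214245k1`, `214245l1`, `259920ed1`, `259920hd1`, `283220bc1`, `297680t1`, `297680u1`, `317520gf1`, `345960ca1`, `346680t1`, `353440p1`, `389205l1`, `392040bu1`, `471105v1`.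

References: B. Mazur, Invent. Math. 44 (1978) Prop. 6.3 (1) [Mazur1978]; K. Ireland, M. Rosen, GTM 84
(1990) §8.1 [IrelandRosen1990]; J. E. Cremona, *Algorithms for Modular Elliptic Curves* (1997),
Table 1 [CremonaAlgorithms1997].
-/

set_option linter.dupNamespace false

namespace Summit.BirchSwinnertonDyer.Rank1Residual.X11b

open Literature.NumberTheory.EllipticCurves

/-- `#Ẽ(𝔽_7) = 8` (`a_7 = 0`; `X² − a_7X + 7` root-free mod `p = 5`) for Cremona's model `169920cp1`. [folklore] -/
theorem card_j169920cp1_7 :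
    Nat.card (((⟨0, 0, 0, -49542, -3012926⟩ : WeierstrassCurve ℤ).map (Int.castRingHom (ZMod 7))).toAffine.Point) = 8 := by
  rw [@WeierstrassCurve.natCard_point_eq_one_add_card (ZMod 7) (@ZMod.instField 7 ⟨by norm_num⟩) _ _ _
    (by decide +kernel), @card_sol_eq_sum_euler (ZMod 7) (@ZMod.instField 7 ⟨by norm_num⟩) _ _
    (by rw [ZMod.ringChar_zmod_n]; decide), ZMod.card]
  decide +kernel

/-- `#Ẽ(𝔽_7) = 8` (`a_7 = 0`; `X² − a_7X + 7` root-free mod `p = 5`) for Cremona's model `169920dc1`. [folklore] -/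
theorem card_j169920dc1_7 :
    Nat.card (((⟨0, 0, 0, -445878, 81349002⟩ : WeierstrassCurve ℤ).map (Int.castRingHom (ZMod 7))).toAffine.Point) = 8 := by
  rw [@WeierstrassCurve.natCard_point_eq_one_add_card (ZMod 7) (@ZMod.instField 7 ⟨by norm_num⟩) _ _ _
    (by decide +kernel), @card_sol_eq_sum_euler (ZMod 7) (@ZMod.instField 7 ⟨by norm_num⟩) _ _
    (by rw [ZMod.ringChar_zmod_n]; decide), ZMod.card]
  decide +kernel

/-- `#Ẽ(𝔽_7) = 13` (`a_7 = -5`; `X² − a_7X + 7` root-free mod `p = 5`) for Cremona's model `184960ce1`. [folklore] -/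
theorem card_j184960ce1_7 :
    Nat.card (((⟨0, 1, 0, -641965, -200268437⟩ : WeierstrassCurve ℤ).map (Int.castRingHom (ZMod 7))).toAffine.Point) = 13 := by
  rw [@WeierstrassCurve.natCard_point_eq_one_add_card (ZMod 7) (@ZMod.instField 7 ⟨by norm_num⟩) _ _ _
    (by decide +kernel), @card_sol_eq_sum_euler (ZMod 7) (@ZMod.instField 7 ⟨by norm_num⟩) _ _
    (by rw [ZMod.ringChar_zmod_n]; decide), ZMod.card]
  decide +kernel

/-- `#Ẽ(𝔽_11) = 13` (`a_11 = -1`; `X² − a_11X + 11` root-free mod `p = 5`) for Cremona's model `208080j1`. [folklore] -/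
theorem card_j208080j1_11 :
    Nat.card (((⟨0, 0, 0, -707472, -207466164⟩ : WeierstrassCurve ℤ).map (Int.castRingHom (ZMod 11))).toAffine.Point) = 13 := by
  rw [@WeierstrassCurve.natCard_point_eq_one_add_card (ZMod 11) (@ZMod.instField 11 ⟨by norm_num⟩) _ _ _
    (by decide +kernel), @card_sol_eq_sum_euler (ZMod 11) (@ZMod.instField 11 ⟨by norm_num⟩) _ _
    (by rw [ZMod.ringChar_zmod_n]; decide), ZMod.card]
  decide +kernel

/-- `#Ẽ(𝔽_7) = 8` (`a_7 = 0`; `X² − a_7X + 7` root-free mod `p = 5`) for Cremona's model `214245k1`. [folklore] -/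
theorem card_j214245k1_7 :
    Nat.card (((⟨0, 0, 1, -73002, 3428052⟩ : WeierstrassCurve ℤ).map (Int.castRingHom (ZMod 7))).toAffine.Point) = 8 := by
  rw [@WeierstrassCurve.natCard_point_eq_one_add_card (ZMod 7) (@ZMod.instField 7 ⟨by norm_num⟩) _ _ _
    (by decide +kernel), @card_sol_eq_sum_euler (ZMod 7) (@ZMod.instField 7 ⟨by norm_num⟩) _ _
    (by rw [ZMod.ringChar_zmod_n]; decide), ZMod.card]
  decide +kernel

/-- `#Ẽ(𝔽_7) = 8` (`a_7 = 0`; `X² − a_7X + 7` root-free mod `p = 5`) for Cremona's model `214245l1`. [folklore] -/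
theorem card_j214245l1_7 :
    Nat.card (((⟨0, 0, 1, -1242, 7607⟩ : WeierstrassCurve ℤ).map (Int.castRingHom (ZMod 7))).toAffine.Point) = 8 := by
  rw [@WeierstrassCurve.natCard_point_eq_one_add_card (ZMod 7) (@ZMod.instField 7 ⟨by norm_num⟩) _ _ _
    (by decide +kernel), @card_sol_eq_sum_euler (ZMod 7) (@ZMod.instField 7 ⟨by norm_num⟩) _ _
    (by rw [ZMod.ringChar_zmod_n]; decide), ZMod.card]
  decide +kernel

/-- `#Ẽ(𝔽_11) = 18` (`a_11 = -6`; `X² − a_11X + 11` root-free mod `p = 5`) for Cremona's model `259920ed1`. [folklore] -/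
theorem card_j259920ed1_11 :
    Nat.card (((⟨0, 0, 0, 1083, -14801⟩ : WeierstrassCurve ℤ).map (Int.castRingHom (ZMod 11))).toAffine.Point) = 18 := by
  rw [@WeierstrassCurve.natCard_point_eq_one_add_card (ZMod 11) (@ZMod.instField 11 ⟨by norm_num⟩) _ _ _
    (by decide +kernel), @card_sol_eq_sum_euler (ZMod 11) (@ZMod.instField 11 ⟨by norm_num⟩) _ _
    (by rw [ZMod.ringChar_zmod_n]; decide), ZMod.card]
  decide +kernel

/-- `#Ẽ(𝔽_7) = 3` (`a_7 = 5`; `X² − a_7X + 7` root-free mod `p = 5`) for Cremona's model `259920hd1`. [folklore] -/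
theorem card_j259920hd1_7 :
    Nat.card (((⟨0, 0, 0, 36708, 3975199⟩ : WeierstrassCurve ℤ).map (Int.castRingHom (ZMod 7))).toAffine.Point) = 3 := by
  rw [@WeierstrassCurve.natCard_point_eq_one_add_card (ZMod 7) (@ZMod.instField 7 ⟨by norm_num⟩) _ _ _
    (by decide +kernel), @card_sol_eq_sum_euler (ZMod 7) (@ZMod.instField 7 ⟨by norm_num⟩) _ _
    (by rw [ZMod.ringChar_zmod_n]; decide), ZMod.card]
  decide +kernel

/-- `#Ẽ(𝔽_3) = 4` (`a_3 = 0`; `X² − a_3X + 3` root-free mod `p = 5`) for Cremona's model `283220bc1`. [folklore] -/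
theorem card_j283220bc1_3 :
    Nat.card (((⟨0, 0, 0, -3851792, 2635588676⟩ : WeierstrassCurve ℤ).map (Int.castRingHom (ZMod 3))).toAffine.Point) = 4 := by
  rw [@WeierstrassCurve.natCard_point_eq_one_add_card (ZMod 3) (@ZMod.instField 3 ⟨by norm_num⟩) _ _ _
    (by decide +kernel), @card_sol_eq_sum_euler (ZMod 3) (@ZMod.instField 3 ⟨by norm_num⟩) _ _
    (by rw [ZMod.ringChar_zmod_n]; decide), ZMod.card]
  decide +kernel

/-- `#Ẽ(𝔽_7) = 8` (`a_7 = 0`; `X² − a_7X + 7` root-free mod `p = 5`) for Cremona's model `297680t1`. [folklore] -/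
theorem card_j297680t1_7 :
    Nat.card (((⟨0, 1, 0, -75660, -595909192⟩ : WeierstrassCurve ℤ).map (Int.castRingHom (ZMod 7))).toAffine.Point) = 8 := by
  rw [@WeierstrassCurve.natCard_point_eq_one_add_card (ZMod 7) (@ZMod.instField 7 ⟨by norm_num⟩) _ _ _
    (by decide +kernel), @card_sol_eq_sum_euler (ZMod 7) (@ZMod.instField 7 ⟨by norm_num⟩) _ _
    (by rw [ZMod.ringChar_zmod_n]; decide), ZMod.card]
  decide +kernel

/-- `#Ẽ(𝔽_7) = 8` (`a_7 = 0`; `X² − a_7X + 7` root-free mod `p = 5`) for Cremona's model `297680u1`. [folklore] -/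
theorem card_j297680u1_7 :
    Nat.card (((⟨0, 1, 0, -20, -2632⟩ : WeierstrassCurve ℤ).map (Int.castRingHom (ZMod 7))).toAffine.Point) = 8 := by
  rw [@WeierstrassCurve.natCard_point_eq_one_add_card (ZMod 7) (@ZMod.instField 7 ⟨by norm_num⟩) _ _ _
    (by decide +kernel), @card_sol_eq_sum_euler (ZMod 7) (@ZMod.instField 7 ⟨by norm_num⟩) _ _
    (by rw [ZMod.ringChar_zmod_n]; decide), ZMod.card]
  decide +kernel

/-- `#Ẽ(𝔽_11) = 13` (`a_11 = -1`; `X² − a_11X + 11` root-free mod `p = 5`) for Cremona's model `317520gf1`. [folklore] -/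
theorem card_j317520gf1_11 :
    Nat.card (((⟨0, 0, 0, -46452, -3851204⟩ : WeierstrassCurve ℤ).map (Int.castRingHom (ZMod 11))).toAffine.Point) = 13 := by
  rw [@WeierstrassCurve.natCard_point_eq_one_add_card (ZMod 11) (@ZMod.instField 11 ⟨by norm_num⟩) _ _ _
    (by decide +kernel), @card_sol_eq_sum_euler (ZMod 11) (@ZMod.instField 11 ⟨by norm_num⟩) _ _
    (by rw [ZMod.ringChar_zmod_n]; decide), ZMod.card]
  decide +kernel

/-- `#Ẽ(𝔽_11) = 6` (`a_11 = 6`; `X² − a_11X + 11` root-free mod `p = 5`) for Cremona's model `345960ca1`. [folklore] -/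
theorem card_j345960ca1_11 :
    Nat.card (((⟨0, 0, 0, -1698087, -4267590541⟩ : WeierstrassCurve ℤ).map (Int.castRingHom (ZMod 11))).toAffine.Point) = 6 := by
  rw [@WeierstrassCurve.natCard_point_eq_one_add_card (ZMod 11) (@ZMod.instField 11 ⟨by norm_num⟩) _ _ _
    (by decide +kernel), @card_sol_eq_sum_euler (ZMod 11) (@ZMod.instField 11 ⟨by norm_num⟩) _ _
    (by rw [ZMod.ringChar_zmod_n]; decide), ZMod.card]
  decide +kernel

/-- `#Ẽ(𝔽_7) = 3` (`a_7 = 5`; `X² − a_7X + 7` root-free mod `p = 5`) for Cremona's model `346680t1`. [folklore] -/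
theorem card_j346680t1_7 :
    Nat.card (((⟨0, 0, 0, -1846467, -1004187474⟩ : WeierstrassCurve ℤ).map (Int.castRingHom (ZMod 7))).toAffine.Point) = 3 := by
  rw [@WeierstrassCurve.natCard_point_eq_one_add_card (ZMod 7) (@ZMod.instField 7 ⟨by norm_num⟩) _ _ _
    (by decide +kernel), @card_sol_eq_sum_euler (ZMod 7) (@ZMod.instField 7 ⟨by norm_num⟩) _ _
    (by rw [ZMod.ringChar_zmod_n]; decide), ZMod.card]
  decide +kernel

/-- `#Ẽ(𝔽_3) = 4` (`a_3 = 0`; `X² − a_3X + 3` root-free mod `p = 5`) for Cremona's model `353440p1`. [folklore] -/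
theorem card_j353440p1_3 :
    Nat.card (((⟨0, 0, 0, -12737, -553284⟩ : WeierstrassCurve ℤ).map (Int.castRingHom (ZMod 3))).toAffine.Point) = 4 := by
  rw [@WeierstrassCurve.natCard_point_eq_one_add_card (ZMod 3) (@ZMod.instField 3 ⟨by norm_num⟩) _ _ _
    (by decide +kernel), @card_sol_eq_sum_euler (ZMod 3) (@ZMod.instField 3 ⟨by norm_num⟩) _ _
    (by rw [ZMod.ringChar_zmod_n]; decide), ZMod.card]
  decide +kernel

/-- `#Ẽ(𝔽_7) = 8` (`a_7 = 0`; `X² − a_7X + 7` root-free mod `p = 5`) for Cremona's model `389205l1`. [folklore] -/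
theorem card_j389205l1_7 :
    Nat.card (((⟨0, 0, 1, -2232, -40525⟩ : WeierstrassCurve ℤ).map (Int.castRingHom (ZMod 7))).toAffine.Point) = 8 := by
  rw [@WeierstrassCurve.natCard_point_eq_one_add_card (ZMod 7) (@ZMod.instField 7 ⟨by norm_num⟩) _ _ _
    (by decide +kernel), @card_sol_eq_sum_euler (ZMod 7) (@ZMod.instField 7 ⟨by norm_num⟩) _ _
    (by rw [ZMod.ringChar_zmod_n]; decide), ZMod.card]
  decide +kernel

/-- `#Ẽ(𝔽_7) = 8` (`a_7 = 0`; `X² − a_7X + 7` root-free mod `p = 5`) for Cremona's model `392040bu1`. [folklore] -/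
theorem card_j392040bu1_7 :
    Nat.card (((⟨0, 0, 0, -1032372, -403500636⟩ : WeierstrassCurve ℤ).map (Int.castRingHom (ZMod 7))).toAffine.Point) = 8 := by
  rw [@WeierstrassCurve.natCard_point_eq_one_add_card (ZMod 7) (@ZMod.instField 7 ⟨by norm_num⟩) _ _ _
    (by decide +kernel), @card_sol_eq_sum_euler (ZMod 7) (@ZMod.instField 7 ⟨by norm_num⟩) _ _
    (by rw [ZMod.ringChar_zmod_n]; decide), ZMod.card]
  decide +kernel

/-- `#Ẽ(𝔽_13) = 19` (`a_13 = -5`; `X² − a_13X + 13` root-free mod `p = 5`) for Cremona's model `471105v1`. [folklore] -/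
theorem card_j471105v1_13 :
    Nat.card (((⟨0, 0, 1, -96423822, -409535013130⟩ : WeierstrassCurve ℤ).map (Int.castRingHom (ZMod 13))).toAffine.Point) = 19 := by
  rw [@WeierstrassCurve.natCard_point_eq_one_add_card (ZMod 13) (@ZMod.instField 13 ⟨by norm_num⟩) _ _ _
    (by decide +kernel), @card_sol_eq_sum_euler (ZMod 13) (@ZMod.instField 13 ⟨by norm_num⟩) _ _
    (by rw [ZMod.ringChar_zmod_n]; decide), ZMod.card]
  decide +kernel

end Summit.BirchSwinnertonDyer.Rank1Residual.X11b
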